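import Literature.AlgebraicGeometry.ComplexMultiplication.CMWeilSectionWeilTypeOfMarkman
import Literature.AlgebraicGeometry.HodgeTheory.DefiniteQuaternionFourfoldHodgeClasses
import Literature.AlgebraicGeometry.HodgeTheory.AbelianLowDimensionNoncommutativeFourfoldsHolds
import Literature.AlgebraicGeometry.HodgeTheory.AbelianLowDimensionFivefoldCodimTwoHolds
import HarnessLib

/-!
# Moonen–Zarhin 1999 Thm. 0.1, codimension two, for EVERY complex abelian fourfold — DISCHARGE of
# `MoonenZarhin1999_codimTwoHodgeClasses_abelianFourfold` (`B²(X) ⊆ D²(X) + Σ_K W_K`) and of the `dim ≤ 5` reduction fact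
# `MoonenZarhin1999_hodgeClasses_abelian_dim_le_five_of_weilClassesFourfolds` (Markman's fourfold theorem ⟹ HC in dim `≤ 5`)

The printed statement (Math. Ann. 315 (1999), Thm. 0.1 with (1.4), (1.9)): for a complex abelian variety of dimension `4`,
every rational `(2,2)` class lies in the span of products of divisor classes and of the Weil classes `W_K` of the imaginary
quadratic `K = ℚ(φ) ⊂ End⁰(X)`, `φ² = -d`, acting with multiplicities `(2,2)`. The proof re-homed here is the row-four
census of the Summits cell `Ring2` over the table of endomorphism algebras of simple abelian fourfolds (Moonen–Zarhin 1995
Thm. 2.4; Shimura 1963 Thm. 5): (Part 1) EVERY fourfold of CM type (simple: Pohlmann / the CM fourfold classification;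
CM products: Weil sections, `CMWeilSectionWeilTypeOfMarkman`) and every NON-SIMPLE fourfold satisfy the statement, so the
fact localises to the SIMPLE non-CM fourfolds; Ribet type `(3,1)`, minimal quaternion type (Banaszak–Gajda–Krasoń), real
multiplication by a totally real quartic field and quartic CM type `{(1,1),(2,0)}` are `B = D`; (Parts 2–7) the remaining
Albert rows leave the residual one by one — IV(1,1) (imaginary quadratic `End⁰`: the Weil classes ARE the `W_K`), I(2)
(real quadratic multiplication of relative dimension two), II over `ℚ` of quaternion rank two, I(1) with symplectic Hodge
Lie algebra and then ALL of I(1) (`End⁰ = ℚ`: `B² ⊆ D²`, MZ99 Thm. (0.1)(3)), III over `ℚ` (definite quaternion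
multiplication: the tree's `DefiniteQuaternionFourfoldHodgeClasses`); (Part 8) NO simple non-CM fourfold is left
(`rowFour_residual_false`: Albert's arithmetic `d²e ∣ 8`, the rows IV(2,1) `⊇ k (2,2)` and IV `d = 2` being EMPTY by
Shimura 1963 Thm. 5 (4), (5) — the tree's `ShimuraExceptionalTypeIVFourfolds` and the already re-homed
`NoncommutativeFourfold` lemmas), whence **`Literature.AlgebraicGeometry.HodgeTheory.MoonenZarhin1999_codimTwoHodgeClasses_abelianFourfold_holds`**
(instance-free, `HodgeTensorFacts` discharged by the tree's `hodgeTensorFacts_holds`) and, through Part 7 of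
`AbelianLowDimensionFivefoldCodimTwoHolds`, **`Literature.AlgebraicGeometry.HodgeTheory.MoonenZarhin1999_hodgeClasses_abelian_dim_le_five_of_weilClassesFourfolds_holds`**.

WHAT IS NOT CLAIMED: Markman's theorem (`Markman2025_weilClasses_algebraic_abelianFourfold`) is never asserted — it is the
ANTECEDENT of the `dim ≤ 5` fact; nothing is said in dimension `≥ 6`; no existence statement about endomorphism algebras
(only non-existence of the two exceptional rows); the Hodge conjecture for abelian varieties is NOT proved here. Net
named-fact debt −2.

* Part 1 — from `Ring2/NonSimpleFourfoldsCodimTwo` (9/12 declarations; namespace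
  `Literature.AlgebraicGeometry.HodgeTheory.AbelianLowDimension.NonSimpleFourfoldsCodimTwo`): MOONEN–ZARHIN Thm. 0.1
  IN CODIMENSION 2 — `B²(X) ⊆ D²(X) + Σ_K W_K` — FOR EVERY COMPLEX ABELIAN FOURFOLD OF CM TYPE AND FOR EVERY
  NON-SIMPLE FOURFOLD, UNCONDITIONALLY; the named fact `MoonenZarhin1999_codimTwoHodgeClasses_abelianFourfold`
  localised to the …. Declarations: `isCodimTwoDivisorWeilGenerated_of_isOfCMType`,
  `moonenZarhin1999_codimTwoHodgeClasses_abelianFourfold_iff_isSimple_not_isOfCMType`,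
  `isCodimTwoDivisorWeilGenerated_of_ribetTypeOne`, `isCodimTwoDivisorWeilGenerated_of_isSimple_of_exists_quaternion`,
  `moonenZarhin1999_codimTwoHodgeClasses_abelianFourfold_iff_residual`,
  `isCodimTwoDivisorWeilGenerated_of_isTotallyReal`,
  `moonenZarhin1999_codimTwoHodgeClasses_abelianFourfold_iff_residual'`,
  `isCodimTwoDivisorWeilGenerated_of_quarticCM`,
  `moonenZarhin1999_codimTwoHodgeClasses_abelianFourfold_iff_residual''`.
* Part 2 — from `Ring2/RowFourTypeIVOneOne` (1/7 declarations; namespace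
  `Literature.AlgebraicGeometry.HodgeTheory.AbelianLowDimension.RowFourTypeIVOneOne`): TYPE IV(1,1) LEAVES THE
  ROW-FOUR RESIDUAL — the fourfold fact and `HCUpToDim 5` modulo Markman localise to the simple non-CM fourfolds whose
  endomorphism algebra is NOT an imaginary quadratic field. Declarations:
  `moonenZarhin1999_codimTwoHodgeClasses_abelianFourfold_iff_residual_noImaginaryQuadratic`.
* Part 3 — from `Ring2/RowFourTypeITwo` (2/9 declarations; namespace
  `Literature.AlgebraicGeometry.HodgeTheory.AbelianLowDimension.RowFourTypeITwo`): TYPE I(2) LEAVES THE ROW-FOUR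
  RESIDUAL — real multiplication of relative dimension two is unconditionally divisorial in all codimensions and all
  powers. Declarations: `isCodimTwoDivisorWeilGenerated_of_isTotallyReal_of_two_mul_finrank_eq`,
  `moonenZarhin1999_codimTwoHodgeClasses_abelianFourfold_iff_residual_noRelDimTwoRM`.
* Part 4 — from `Ring2/RowFourTypeIIOverQ` (2/10 declarations; namespace
  `Literature.AlgebraicGeometry.HodgeTheory.AbelianLowDimension.RowFourTypeIIOverQ`): TYPE II OVER `ℚ` LEAVES THE
  ROW-FOUR RESIDUAL — a simple abelian variety with `End⁰` a totally indefinite quaternion algebra over a totally real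
  `K` and `dim = 4[K:ℚ]` is unconditionally divisorial in all codimensions and all powers. Declarations:
  `isCodimTwoDivisorWeilGenerated_of_isSimple_isTotallyIndefinite_rankTwo`,
  `moonenZarhin1999_codimTwoHodgeClasses_abelianFourfold_iff_residual_noTypeIIRankTwo`.
* Part 5 — from `Ring2/RowFourTypeIOneSymplectic` (3/11 declarations; namespace
  `Literature.AlgebraicGeometry.HodgeTheory.AbelianLowDimension.RowFourTypeIOneSymplectic`): TYPE I(1) WITH SYMPLECTIC
  HODGE LIE ALGEBRA LEAVES THE ROW-FOUR RESIDUAL — an abelian variety whose complexified Hodge Lie algebra contains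
  every `ψ_ℂ`-skew operator (`Hg = Sp`) is unconditionally divisorial in all codimensions and all powers; an abelian
  …. Declarations: `isDivisorGenerated_of_hodgeLieC_sp`, `isCodimTwoDivisorWeilGenerated_of_hodgeLieC_sp`,
  `moonenZarhin1999_codimTwoHodgeClasses_abelianFourfold_iff_residual_noSymplecticTypeIOne`.
* Part 6 — from `Ring2/RowFourTypeIOneClosed` (3/14 declarations; namespace
  `Literature.AlgebraicGeometry.HodgeTheory.AbelianLowDimension.RowFourTypeIOneClosed`): ROW I(1) IS CLOSED — the
  Hodge conjecture for EVERY complex abelian fourfold with `End⁰ = ℚ`, unconditionally; type I(1) leaves the row-four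
  residual entirely. Declarations: `mem_divisorClassesSpan_two_of_finrank_endAlgebra_eq_one`,
  `isCodimTwoDivisorWeilGenerated_of_finrank_endAlgebra_eq_one`,
  `moonenZarhin1999_codimTwoHodgeClasses_abelianFourfold_iff_residual_noTypeIOne`.
* Part 7 — from `Ring2/RowFourTypeIIIOverQ` (2/8 declarations; namespace
  `Literature.AlgebraicGeometry.HodgeTheory.AbelianLowDimension.RowFourTypeIIIOverQ`): ROW III OVER `ℚ` — `B²(X) ⊆
  D²(X) + Σ_K W_K` for EVERY complex abelian fourfold with definite quaternion multiplication over `ℚ`,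
  unconditionally; type III leaves the row-four residual (modulo Markman). Declarations:
  `isCodimTwoDivisorWeilGenerated_of_isTotallyDefinite_quaternion`,
  `moonenZarhin1999_codimTwoHodgeClasses_abelianFourfold_iff_residual_noTypeIII`.
* Part 8 — from `Ring2/RowFourClosed` (4/15 declarations; namespace
  `Literature.AlgebraicGeometry.HodgeTheory.AbelianLowDimension.RowFourClosed`): ROW FOUR IS CLOSED — the two
  remaining rows IV(2,1) `⊇ k (2,2)` and IV `d = 2` of Moonen–Zarhin 1995 are EMPTY (Shimura 1963 Thm. 5 (4), (5));
  THE FOURFOLD FACT `MoonenZarhin1999_codimTwoHodgeClasses_abelianFourfold` HOLDS; `HCUpToDim 5` MODULO MARKMAN ALONE.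
  Declarations: `rowFour_residual_false`, `moonenZarhin1999_codimTwoHodgeClasses_abelianFourfold_holds'`,
  `moonenZarhin1999_codimTwoHodgeClasses_abelianFourfold_holds`,
  `moonenZarhin1999_hodgeClasses_abelian_dim_le_five_of_weilClassesFourfolds_holds`.

## References

* [MoonenZarhin1999LowDim] B. Moonen, Yu. Zarhin, Math. Ann. 315 (1999) 711–733, Thm. 0.1 with (1.4), (1.9), §5 (5.1),
  (5.3)–(5.5).
* [MoonenZarhin1995Duke] B. Moonen, Yu. Zarhin, Duke Math. J. 77 (1995) 553–581, Thm. 2.4 (simple fourfolds).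
* [Pohlmann1968] H. Pohlmann, Ann. of Math. 88 (1968), Thm. 1.
* [MumfordAV1970] D. Mumford, *Abelian Varieties* (1970), §19 Thm. 1, Cor. 1 and Remark p. 169.
* [Shimura1998] G. Shimura, *Abelian Varieties with Complex Multiplication and Modular Functions*, §5.1 Props. 3–6,
  §7.1.
* [vanGeemen1994HodgeAV] B. van Geemen, LNM 1594 (1994), 3.6–3.7.
* [Ribet1983] K. A. Ribet, Amer. J. Math. 105 (1983), Thm. 3.
* [BanaszakGajdaKrason2006] G. Banaszak, W. Gajda, P. Krasoń, J. Number Theory (2006), Thm. 7.34.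
* [Shimura1963AnalyticFamilies] G. Shimura, Ann. of Math. 78 (1963), §4 Prop. 14.
* [Deligne2000] P. Deligne, *The Hodge conjecture* (Clay problem description, 2000), §1.
* [Murty1984] V. K. Murty, Math. Ann. 268 (1984), §3.
* [Gordon1997] B. B. Gordon, arXiv:alg-geom/9709030, §5.9, §5.10, §7.7 Prop. 7.7.1.
* [Chi1992] W. Chi, Amer. J. Math. 114 (1992), Thm. 7.4.
* [Mumford1969NoteShimura] D. Mumford, Math. Ann. 181 (1969), §4.
* [Lombardo2016] D. Lombardo, *On the ℓ-adic Galois representations …* (2016), Lemma 3.4 (p. 1229).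
* [VoisinHodgeI2002] C. Voisin, *Hodge Theory I* (2002), Thm. 6.25, Rem. 6.27.
* [vanGeemenVerra2003QuaternionicPryms] B. van Geemen, A. Verra, Topology 42 (2003), Lemma 4.5.
* [HulekLaface2019PicardNumbersAV] K. Hulek, R. Laface, Ann. Sc. Norm. Super. Pisa 19 (2019), Prop. 5.1 (4), (5) and
  proof.

Provenance: Literature home of the used declarations of the Summits-side modules listed part by part above (cells
`pub-hodge-ring2` / `pub-hodgecm2`; namespaces `Summit.HodgeConjecture.Ring2.NonSimpleFourfoldsCodimTwo`,
`Summit.HodgeConjecture.Ring2.RowFourClosed`, `Summit.HodgeConjecture.Ring2.RowFourTypeIIIOverQ`,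
`Summit.HodgeConjecture.Ring2.RowFourTypeIIOverQ`, `Summit.HodgeConjecture.Ring2.RowFourTypeIOneClosed`,
`Summit.HodgeConjecture.Ring2.RowFourTypeIOneSymplectic`, `Summit.HodgeConjecture.Ring2.RowFourTypeITwo`,
`Summit.HodgeConjecture.Ring2.RowFourTypeIVOneOne` re-rooted under `Literature.AlgebraicGeometry.…` as stated), whose
imports are `Literature/` and Mathlib only for the declarations used; re-homed verbatim (proofs unchanged) so that
Literature users are served without importing `Summits/`. Lane `lit-hodgefound`, seat p20 (generation 34). Theorems
only: no definition, no named fact, no `sorry`; axioms `propext`, `Classical.choice`, `Quot.sound`.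
-/

/-! ## Part 1: NonSimpleFourfoldsCodimTwo -/

noncomputable section

open _root_.CategoryTheory _root_.CategoryTheory.Limits NumberField

namespace Literature.AlgebraicGeometry.HodgeTheory.AbelianLowDimension.NonSimpleFourfoldsCodimTwo

open Literature.AlgebraicGeometry.Motives (AbelianVariety)
open Literature.AlgebraicGeometry.Motives.AbelianVariety
open Literature.AlgebraicGeometry.HodgeTheory
open Literature.AlgebraicGeometry.Milne1999
open Literature.NumberTheory.Automorphic (IsQuaternionAlgebra)
open Literature.AlgebraicGeometry.ComplexMultiplication.Domination
open Literature.AlgebraicGeometry.ComplexMultiplication.CMWeights (exists_biproduct_family_of_isProductOf moonenZarhin_codimTwo_biproduct_cm)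

variable {X : AbelianVariety ℂ}

/-! ### §1 Every complex abelian fourfold of CM type -/

/-- **MOONEN–ZARHIN Thm. 0.1 IN CODIMENSION 2 FOR EVERY COMPLEX ABELIAN FOURFOLD OF CM TYPE — UNCONDITIONAL:
`B²(X) ⊆ D²(X) + Σ_K W_K`** (simple or not: the simple CM fourfolds, the CM members `E_k × T` of case (a) — (a2), `T`
simple with sextic CM field `⊇ k` —, products of CM surfaces and curves). `X` is isogenous to a product `B` of CM-typed
abelian varieties (Poincaré + Shimura, `hDecompPos_of_hSimplePos` at Riemann's theorem), `B` is dominated by — being of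
the same dimension, isogenous to — a biproduct `⨁_i C_i` of CM realisations of total dimension `4`, where the CorCM
calculus proves the conclusion hypothesis-free (`moonenZarhin_codimTwo_biproduct_cm`); the predicate travels back along
the two isogenies (`IsCodimTwoDivisorWeilGenerated.of_isIsogeny`, `.of_isIsogenous`).
[cite: MoonenZarhin1999LowDim, Thm. 0.1 with (1.4), (1.9) and §5 (5.1), (5.3), (5.5)] [cite: Pohlmann1968, Thm. 1]
[cite: MumfordAV1970, §19 Thm. 1 and Remark p. 169] [cite: Shimura1998, §5.1 Props. 3–6 and §7.1] -/
theorem isCodimTwoDivisorWeilGenerated_of_isOfCMType (hX4 : X.dim = 4) (hcm : IsOfCMType X) :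
    IsCodimTwoDivisorWeilGenerated X := by
  obtain ⟨B, hB, hXB⟩ :=
    hDecompPos_of_hSimplePos (hSimplePos_of_riemann deligneMilne1982_Thm_6_20_full_holds) X (by omega) hcm
  obtain ⟨n, K, iF, iN, iC, C, Φ, ι, θ, hC, hdom, hdim⟩ := exists_biproduct_family_of_isProductOf hB
  have hBdim : B.dim = 4 := by
    obtain ⟨g, hg⟩ := hXB
    rw [← dim_eq_of_isIsogeny hg, hX4]
  have hCdim : (⨁ C).dim = 4 := hdim.trans hBdim
  have hP : IsCodimTwoDivisorWeilGenerated (⨁ C) := fun c hc hH =>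
    moonenZarhin_codimTwo_biproduct_cm hC hCdim c hc hH
  obtain ⟨s, π, N, hN, hsπ⟩ := hdom
  have hs : AbelianVariety.IsIsogeny s :=
    isIsogeny_of_comp_eq_nsmul_id (K := ℂ) (Nat.cast_ne_zero.2 hN) hsπ (hBdim.trans hCdim.symm)
  exact (hP.of_isIsogeny hs).of_isIsogenous hXB

/-! ### §2 Every non-simple complex abelian fourfold -/

/-- **LOCALISATION OF THE NAMED FACT.** `MoonenZarhin1999_codimTwoHodgeClasses_abelianFourfold` (Thm. 0.1 in
codimension `2` for ALL fourfolds) is EQUIVALENT to its instances at the SIMPLE complex abelian fourfolds NOT of CM type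
— exactly the content of Moonen–Zarhin 1995 (Duke 77) that the tree has not proved («we already know this in case `X`
is simple»): the non-simple fourfolds (§2) and the CM fourfolds (§1) are theorems. [cite: MoonenZarhin1999LowDim, Thm. 0.1 and §5 (5.1)]
[cite: MoonenZarhin1995Duke, Thm. 2.4] -/
theorem moonenZarhin1999_codimTwoHodgeClasses_abelianFourfold_iff_isSimple_not_isOfCMType :
    MoonenZarhin1999_codimTwoHodgeClasses_abelianFourfold ↔
      ∀ A : AbelianVariety ℂ, A.dim = 4 → A.IsSimple → ¬ IsOfCMType A → IsCodimTwoDivisorWeilGenerated A :=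
  ⟨fun h A hA _ _ => h A hA, fun hS =>
    moonenZarhin1999_codimTwoHodgeClasses_abelianFourfold_of_isOfCMType_of_isSimple
      (fun _ hA hcm => isCodimTwoDivisorWeilGenerated_of_isOfCMType hA hcm) hS⟩

/-- **A simple fourfold of RIBET TYPE `(3,1)`** (`dim_ℚ End⁰(A) = 2`, `φ ≫ φ = -d` with an eigenvalue of multiplicity `1`
on `H^{1,0}`) **has `B = D`** (Ribet 1983 Thm. 3, the tree's `AbelianVariety.isDivisorGenerated_of_ribetTypeOne`), hence
`B² ⊆ D² + Σ W_K`. [cite: Ribet1983, Thm. 3] [cite: MoonenZarhin1999LowDim, §2 (2.3) and Thm. 0.1] -/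
theorem isCodimTwoDivisorWeilGenerated_of_ribetTypeOne {A : AbelianVariety ℂ} (hA4 : A.dim = 4) (φ : A ⟶ A) {d : ℕ}
    (hd : 0 < d) (hφ : φ ≫ φ = -(d • 𝟙 A)) (hE2 : Module.finrank ℚ A.endAlgebra = 2)
    (h1 : eigenMultiplicity A φ (Complex.I * (Real.sqrt d : ℂ)) = 1 ∨
      eigenMultiplicity A φ (-(Complex.I * (Real.sqrt d : ℂ))) = 1) :
    IsCodimTwoDivisorWeilGenerated A :=
  (AbelianVariety.isDivisorGenerated_of_ribetTypeOne A φ hd hφ hE2 h1 (by omega)).isCodimTwoDivisorWeilGenerated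

/-- **A simple fourfold of MINIMAL QUATERNION TYPE** (`End⁰(A)` a quaternion algebra over a totally real field `K`,
`dim A = 2[K:ℚ]`) **has `B = D`** (Banaszak–Gajda–Krasoń 7.34, the tree's
`AbelianVariety.isDivisorGenerated_of_isSimple_quaternion_of_dim_eq`), hence `B² ⊆ D² + Σ W_K`; the structure packaged
as an existential over `K` and its instances (as in `Ring2/LowDimensionHodgeOfMarkmanRowFour`).
[cite: BanaszakGajdaKrason2006, Thm. 7.34] [cite: MoonenZarhin1999LowDim, Thm. 0.1] -/
theorem isCodimTwoDivisorWeilGenerated_of_isSimple_of_exists_quaternion {A : AbelianVariety ℂ} (hs : A.IsSimple)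
    (hQ : ∃ (K : Type) (_ : Field K) (_ : NumberField K) (_ : IsTotallyReal K) (_ : Algebra K A.endAlgebra)
      (_ : IsScalarTower ℚ K A.endAlgebra) (_ : IsQuaternionAlgebra K A.endAlgebra), A.dim = 2 * Module.finrank ℚ K) :
    IsCodimTwoDivisorWeilGenerated A := by
  obtain ⟨K, _, _, _, _, _, _, hdim⟩ := hQ
  exact (AbelianVariety.isDivisorGenerated_of_isSimple_quaternion_of_dim_eq hs hdim).isCodimTwoDivisorWeilGenerated

/-- **THE RESIDUAL OF THE NAMED FACT.** `MoonenZarhin1999_codimTwoHodgeClasses_abelianFourfold` is EQUIVALENT to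
`B² ⊆ D² + Σ W_K` on the simple complex abelian fourfolds that are not of CM type, NOT of Ribet type `(3,1)` and NOT of
minimal quaternion type — the rest of Moonen–Zarhin 1995 (types I(1), I(2), I(4), non-minimal II, III, IV(1,1) of Weil
type `(2,2)`, IV(2,1), IV with `d = 2`), the same residual class as the cell's row-`4` axis statement
`LowDimOfMarkman.hcAtDim_four_iff_of_markman'`. [cite: MoonenZarhin1999LowDim, Thm. 0.1 and §5 (5.1)]
[cite: MoonenZarhin1995Duke, Thm. 2.4] [cite: Ribet1983, Thm. 3] [cite: BanaszakGajdaKrason2006, Thm. 7.34] -/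
theorem moonenZarhin1999_codimTwoHodgeClasses_abelianFourfold_iff_residual :
    MoonenZarhin1999_codimTwoHodgeClasses_abelianFourfold ↔
      ∀ A : AbelianVariety ℂ, A.dim = 4 → A.IsSimple → ¬ IsOfCMType A →
        (¬ ∃ (φ : A ⟶ A) (d : ℕ), 0 < d ∧ φ ≫ φ = -(d • 𝟙 A) ∧ Module.finrank ℚ A.endAlgebra = 2 ∧
          (eigenMultiplicity A φ (Complex.I * (Real.sqrt d : ℂ)) = 1 ∨
            eigenMultiplicity A φ (-(Complex.I * (Real.sqrt d : ℂ))) = 1)) →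
        (¬ ∃ (K : Type) (_ : Field K) (_ : NumberField K) (_ : IsTotallyReal K) (_ : Algebra K A.endAlgebra)
          (_ : IsScalarTower ℚ K A.endAlgebra) (_ : IsQuaternionAlgebra K A.endAlgebra),
            A.dim = 2 * Module.finrank ℚ K) →
        IsCodimTwoDivisorWeilGenerated A := by
  rw [moonenZarhin1999_codimTwoHodgeClasses_abelianFourfold_iff_isSimple_not_isOfCMType]
  refine ⟨fun h A hA hs hcm _ _ => h A hA hs hcm, fun h A hA hs hcm => ?_⟩
  by_cases hR : ∃ (φ : A ⟶ A) (d : ℕ), 0 < d ∧ φ ≫ φ = -(d • 𝟙 A) ∧ Module.finrank ℚ A.endAlgebra = 2 ∧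
      (eigenMultiplicity A φ (Complex.I * (Real.sqrt d : ℂ)) = 1 ∨
        eigenMultiplicity A φ (-(Complex.I * (Real.sqrt d : ℂ))) = 1)
  · obtain ⟨φ, d, hd, hφ, hE2, h1⟩ := hR
    exact isCodimTwoDivisorWeilGenerated_of_ribetTypeOne hA φ hd hφ hE2 h1
  by_cases hQ : ∃ (K : Type) (_ : Field K) (_ : NumberField K) (_ : IsTotallyReal K) (_ : Algebra K A.endAlgebra)
      (_ : IsScalarTower ℚ K A.endAlgebra) (_ : IsQuaternionAlgebra K A.endAlgebra), A.dim = 2 * Module.finrank ℚ K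
  · exact isCodimTwoDivisorWeilGenerated_of_isSimple_of_exists_quaternion hs hQ
  exact h A hA hs hcm hR hQ

/-! ### §4 On path -/

/-- **A fourfold whose endomorphism algebra is a TOTALLY REAL FIELD OF DEGREE `4 = dim A`** (Albert type I(4):
real multiplication by a totally real quartic field, `End⁰(A) = F`) **has `B = D`** — Ribet 1983 Thm. 0–1 /
Tankeev («`Hg(A) = R_{F/ℚ} SL₂`»), the tree's UNCONDITIONAL `AbelianVariety.isDivisorGenerated_of_isTotallyReal` —,
hence `B² ⊆ D² + Σ W_K`. [cite: Ribet1983, Thm. 1 (p. 524)] [cite: MoonenZarhin1995Duke, Thm. 2.4]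
[cite: MoonenZarhin1999LowDim, Thm. 0.1] -/
theorem isCodimTwoDivisorWeilGenerated_of_isTotallyReal {A : AbelianVariety ℂ} (hF : IsField A.endAlgebra)
    [NumberField.IsTotallyReal (Literature.AlgebraicGeometry.ComplexMultiplication.EndField A hF)] (hdeg : Module.finrank ℚ A.endAlgebra = A.dim) :
    IsCodimTwoDivisorWeilGenerated A :=
  (AbelianVariety.isDivisorGenerated_of_isTotallyReal A hF hdeg).isCodimTwoDivisorWeilGenerated

/-- **THE RESIDUAL OF THE NAMED FACT, REFINED**: `MoonenZarhin1999_codimTwoHodgeClasses_abelianFourfold` is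
EQUIVALENT to `B² ⊆ D² + Σ W_K` on the simple complex abelian fourfolds that are not of CM type, NOT of Ribet type
`(3,1)`, NOT of minimal quaternion type and NOT of maximal real-multiplication type (`End⁰(A)` a totally real field
of degree `4`) — the rest of Moonen–Zarhin 1995: types I(1), I(2), non-minimal II, III, IV(1,1) of Weil type
`(2,2)`, IV(2,1), IV with `d = 2`. The three subtracted sub-rows are unconditional `B = D` theorems of the tree.
[cite: MoonenZarhin1999LowDim, Thm. 0.1 and §5 (5.1)] [cite: MoonenZarhin1995Duke, Thm. 2.4] [cite: Ribet1983, Thm. 1 and Thm. 3]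
[cite: BanaszakGajdaKrason2006, Thm. 7.34] -/
theorem moonenZarhin1999_codimTwoHodgeClasses_abelianFourfold_iff_residual' :
    MoonenZarhin1999_codimTwoHodgeClasses_abelianFourfold ↔
      ∀ A : AbelianVariety ℂ, A.dim = 4 → A.IsSimple → ¬ IsOfCMType A →
        (¬ ∃ (φ : A ⟶ A) (d : ℕ), 0 < d ∧ φ ≫ φ = -(d • 𝟙 A) ∧ Module.finrank ℚ A.endAlgebra = 2 ∧
          (eigenMultiplicity A φ (Complex.I * (Real.sqrt d : ℂ)) = 1 ∨
            eigenMultiplicity A φ (-(Complex.I * (Real.sqrt d : ℂ))) = 1)) →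
        (¬ ∃ (K : Type) (_ : Field K) (_ : NumberField K) (_ : IsTotallyReal K) (_ : Algebra K A.endAlgebra)
          (_ : IsScalarTower ℚ K A.endAlgebra) (_ : IsQuaternionAlgebra K A.endAlgebra),
            A.dim = 2 * Module.finrank ℚ K) →
        (¬ ∃ hF : IsField A.endAlgebra, NumberField.IsTotallyReal (Literature.AlgebraicGeometry.ComplexMultiplication.EndField A hF) ∧
          Module.finrank ℚ A.endAlgebra = A.dim) →
        IsCodimTwoDivisorWeilGenerated A := by
  rw [moonenZarhin1999_codimTwoHodgeClasses_abelianFourfold_iff_residual]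
  refine ⟨fun h A hA hs hcm hR hQ _ => h A hA hs hcm hR hQ, fun h A hA hs hcm hR hQ => ?_⟩
  by_cases hT : ∃ hF : IsField A.endAlgebra, NumberField.IsTotallyReal (Literature.AlgebraicGeometry.ComplexMultiplication.EndField A hF) ∧
      Module.finrank ℚ A.endAlgebra = A.dim
  · obtain ⟨hF, hT, hdeg⟩ := hT
    haveI := hT
    exact isCodimTwoDivisorWeilGenerated_of_isTotallyReal hF hdeg
  exact h A hA hs hcm hR hQ hT

/-! ### §6 (lit gen 64, R37-C) The quartic-CM `{(1,1),(2,0)}` sub-row of the residual -/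

/-- **A simple fourfold of QUARTIC CM TYPE `{(1,1),(2,0)}`** (`dim_ℚ End⁰(A) = 4`, `φ ∈ End(A)` acting on `H^{1,0}`
with eigenvalues `μ₁, μ̄₁` of multiplicity `1` and `μ₂` of multiplicity `2`, the four numbers `μ₁, μ̄₁, μ₂, μ̄₂`
pairwise distinct — Moonen–Zarhin's type IV(2,1) with `End⁰(A) ⊉` an imaginary quadratic `k` of signature `(2,2)`)
**has `B = D`** (the tree's `AbelianVariety.isDivisorGenerated_of_quarticCM`, Thm. 0.2 (4) via (2.4)), hence
`B² ⊆ D² + Σ W_K`. [cite: MoonenZarhin1999LowDim, Thm. 0.1, Thm. 0.2 (4) and §2 (2.4)] [cite: MoonenZarhin1995Duke, Thm. 2.4] -/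
theorem isCodimTwoDivisorWeilGenerated_of_quarticCM {A : AbelianVariety ℂ} (hs : A.IsSimple) (hA4 : A.dim = 4)
    (φ : A ⟶ A) (hE4 : Module.finrank ℚ A.endAlgebra = 4) {μ₁ μ₂ : ℂ} (h11 : starRingEnd ℂ μ₁ ≠ μ₁)
    (h22 : starRingEnd ℂ μ₂ ≠ μ₂) (h12 : μ₂ ≠ μ₁) (h12' : μ₂ ≠ starRingEnd ℂ μ₁)
    (h1 : eigenMultiplicity A φ μ₁ = 1) (h1' : eigenMultiplicity A φ (starRingEnd ℂ μ₁) = 1)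
    (h2 : eigenMultiplicity A φ μ₂ = 2) : IsCodimTwoDivisorWeilGenerated A :=
  (AbelianVariety.isDivisorGenerated_of_quarticCM A hs φ hE4 h11 h22 h12 h12' h1 h1' h2 hA4).isCodimTwoDivisorWeilGenerated

/-- **THE RESIDUAL, THIRD REFINEMENT.** The named fact is EQUIVALENT to `B² ⊆ D² + Σ W_K` on the simple non-CM fourfolds
NOT of Ribet type `(3,1)`, NOT of minimal quaternion type, NOT of maximal real-multiplication type and NOT of quartic CM
type `{(1,1),(2,0)}` — what is left of Moonen–Zarhin 1995: types I(1), I(2), II and III over `ℚ`, IV(1,1) of Weil type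
`(2,2)`, IV(2,1) `⊇ k` of signature `(2,2)`, IV with `d = 2`. [cite: MoonenZarhin1999LowDim, Thm. 0.1, Thm. 0.2 (4) and §2 (2.2)–(2.4)]
[cite: MoonenZarhin1995Duke, Thm. 2.4] [cite: Ribet1983, Thm. 3] [cite: BanaszakGajdaKrason2006, Thm. 7.34] -/
theorem moonenZarhin1999_codimTwoHodgeClasses_abelianFourfold_iff_residual'' :
    MoonenZarhin1999_codimTwoHodgeClasses_abelianFourfold ↔
      ∀ A : AbelianVariety ℂ, A.dim = 4 → A.IsSimple → ¬ IsOfCMType A →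
        (¬ ∃ (φ : A ⟶ A) (d : ℕ), 0 < d ∧ φ ≫ φ = -(d • 𝟙 A) ∧ Module.finrank ℚ A.endAlgebra = 2 ∧
          (eigenMultiplicity A φ (Complex.I * (Real.sqrt d : ℂ)) = 1 ∨
            eigenMultiplicity A φ (-(Complex.I * (Real.sqrt d : ℂ))) = 1)) →
        (¬ ∃ (K : Type) (_ : Field K) (_ : NumberField K) (_ : IsTotallyReal K) (_ : Algebra K A.endAlgebra)
          (_ : IsScalarTower ℚ K A.endAlgebra) (_ : IsQuaternionAlgebra K A.endAlgebra),
            A.dim = 2 * Module.finrank ℚ K) →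
        (¬ ∃ hF : IsField A.endAlgebra, NumberField.IsTotallyReal (Literature.AlgebraicGeometry.ComplexMultiplication.EndField A hF) ∧
          Module.finrank ℚ A.endAlgebra = A.dim) →
        (¬ ∃ (φ : A ⟶ A) (μ₁ μ₂ : ℂ), Module.finrank ℚ A.endAlgebra = 4 ∧ starRingEnd ℂ μ₁ ≠ μ₁ ∧
          starRingEnd ℂ μ₂ ≠ μ₂ ∧ μ₂ ≠ μ₁ ∧ μ₂ ≠ starRingEnd ℂ μ₁ ∧ eigenMultiplicity A φ μ₁ = 1 ∧
          eigenMultiplicity A φ (starRingEnd ℂ μ₁) = 1 ∧ eigenMultiplicity A φ μ₂ = 2) →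
        IsCodimTwoDivisorWeilGenerated A := by
  rw [moonenZarhin1999_codimTwoHodgeClasses_abelianFourfold_iff_residual']
  refine ⟨fun h A hA hs hcm hR hQ hT _ => h A hA hs hcm hR hQ hT, fun h A hA hs hcm hR hQ hT => ?_⟩
  by_cases hC : ∃ (φ : A ⟶ A) (μ₁ μ₂ : ℂ), Module.finrank ℚ A.endAlgebra = 4 ∧ starRingEnd ℂ μ₁ ≠ μ₁ ∧
      starRingEnd ℂ μ₂ ≠ μ₂ ∧ μ₂ ≠ μ₁ ∧ μ₂ ≠ starRingEnd ℂ μ₁ ∧ eigenMultiplicity A φ μ₁ = 1 ∧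
      eigenMultiplicity A φ (starRingEnd ℂ μ₁) = 1 ∧ eigenMultiplicity A φ μ₂ = 2
  · obtain ⟨φ, μ₁, μ₂, hE4, h11, h22, h12, h12', h1, h1', h2⟩ := hC
    exact isCodimTwoDivisorWeilGenerated_of_quarticCM hs hA φ hE4 h11 h22 h12 h12' h1 h1' h2
  exact h A hA hs hcm hR hQ hT hC

end Literature.AlgebraicGeometry.HodgeTheory.AbelianLowDimension.NonSimpleFourfoldsCodimTwo

end

/-! ## Part 2: RowFourTypeIVOneOne -/

noncomputable section

open _root_.CategoryTheory _root_.CategoryTheory.Limits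

namespace Literature.AlgebraicGeometry.HodgeTheory.AbelianLowDimension.RowFourTypeIVOneOne

open Literature.AlgebraicGeometry.Motives (AbelianVariety)
open Literature.AlgebraicGeometry.Motives.AbelianVariety
open Literature.AlgebraicGeometry.HodgeTheory
open Literature.AlgebraicGeometry.ComplexMultiplication
open Literature.AlgebraicGeometry.Milne1999
open NumberField
open Literature.NumberTheory.Automorphic (IsQuaternionAlgebra)
open Literature.AlgebraicGeometry.HodgeTheory.AbelianLowDimension.FivefoldFactHolds
open Literature.AlgebraicGeometry.HodgeTheory.AbelianLowDimension.NonSimpleFourfoldsCodimTwo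

variable {X : AbelianVariety ℂ}

/-! ### §1 The fourfold fact localised past type IV(1,1) -/

/-- **THE RESIDUAL OF THE FOURFOLD FACT, FOURTH REFINEMENT — TYPE IV(1,1) REMOVED.** The named fact
`MoonenZarhin1999_codimTwoHodgeClasses_abelianFourfold` (Thm. 0.1 in codimension two: every abelian fourfold has
`B² ⊆ D² + Σ_k W_k`) is EQUIVALENT to its instances at the simple non-CM fourfolds whose endomorphism algebra is NOT an
imaginary quadratic field (`¬ ∃ φ d, 0 < d ∧ φ ≫ φ = -d ∧ finrank_ℚ End⁰ = 2`) and which are NOT of minimal quaternion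
type, NOT of maximal real-multiplication type, NOT of quartic CM type `{(1,1),(2,0)}`. The previous residual
(`NonSimpleFourfoldsCodimTwo.moonenZarhin1999_codimTwoHodgeClasses_abelianFourfold_iff_residual''`) excluded only the
Ribet sub-row `(3,1)` of type IV(1,1); the `(2,2)` sub-row is now the Literature lane's UNCONDITIONAL
`AbelianVariety.isCodimTwoDivisorWeilGenerated_of_isSimple_of_finrank_end_eq_two` (Moonen–Zarhin 1995: `B² ⊆ D² + W_K`).
[cite: MoonenZarhin1995Duke, Thm. 2.4 and the type IV(1,1) row] [cite: MoonenZarhin1999LowDim, Thm. 0.1, §2 (2.3) and (2.5) (2)]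
[cite: Ribet1983, Thm. 3] [cite: Shimura1963AnalyticFamilies, §4 Prop. 14] -/
theorem moonenZarhin1999_codimTwoHodgeClasses_abelianFourfold_iff_residual_noImaginaryQuadratic :
    MoonenZarhin1999_codimTwoHodgeClasses_abelianFourfold ↔
      ∀ A : AbelianVariety ℂ, A.dim = 4 → A.IsSimple → ¬ IsOfCMType A →
        (¬ ∃ (φ : A ⟶ A) (d : ℕ), 0 < d ∧ φ ≫ φ = -(d • 𝟙 A) ∧ Module.finrank ℚ A.endAlgebra = 2) →
        (¬ ∃ (K : Type) (_ : Field K) (_ : NumberField K) (_ : IsTotallyReal K) (_ : Algebra K A.endAlgebra)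
          (_ : IsScalarTower ℚ K A.endAlgebra) (_ : IsQuaternionAlgebra K A.endAlgebra),
            A.dim = 2 * Module.finrank ℚ K) →
        (¬ ∃ hF : IsField A.endAlgebra, NumberField.IsTotallyReal (EndField A hF) ∧
          Module.finrank ℚ A.endAlgebra = A.dim) →
        (¬ ∃ (φ : A ⟶ A) (μ₁ μ₂ : ℂ), Module.finrank ℚ A.endAlgebra = 4 ∧ starRingEnd ℂ μ₁ ≠ μ₁ ∧
          starRingEnd ℂ μ₂ ≠ μ₂ ∧ μ₂ ≠ μ₁ ∧ μ₂ ≠ starRingEnd ℂ μ₁ ∧ eigenMultiplicity A φ μ₁ = 1 ∧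
          eigenMultiplicity A φ (starRingEnd ℂ μ₁) = 1 ∧ eigenMultiplicity A φ μ₂ = 2) →
        IsCodimTwoDivisorWeilGenerated A := by
  rw [moonenZarhin1999_codimTwoHodgeClasses_abelianFourfold_iff_residual'']
  refine ⟨fun h A hA hs hcm hK hQ hT hC => h A hA hs hcm (fun ⟨φ, d, hd, hφ, hE2, _⟩ => hK ⟨φ, d, hd, hφ, hE2⟩)
    hQ hT hC, fun h A hA hs hcm _ hQ hT hC => ?_⟩
  by_cases hK : ∃ (φ : A ⟶ A) (d : ℕ), 0 < d ∧ φ ≫ φ = -(d • 𝟙 A) ∧ Module.finrank ℚ A.endAlgebra = 2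
  · obtain ⟨φ, d, hd, hφ, hE2⟩ := hK
    exact AbelianVariety.isCodimTwoDivisorWeilGenerated_of_isSimple_of_finrank_end_eq_two A hs φ hd hφ hE2 hA
  exact h A hA hs hcm hK hQ hT hC

end Literature.AlgebraicGeometry.HodgeTheory.AbelianLowDimension.RowFourTypeIVOneOne

end

/-! ## Part 3: RowFourTypeITwo -/

noncomputable section

open _root_.CategoryTheory _root_.CategoryTheory.Limits

namespace Literature.AlgebraicGeometry.HodgeTheory.AbelianLowDimension.RowFourTypeITwo

open Literature.AlgebraicGeometry.Motives (AbelianVariety)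
open Literature.AlgebraicGeometry.Motives.AbelianVariety
open Literature.AlgebraicGeometry.HodgeTheory
open Literature.AlgebraicGeometry.ComplexMultiplication
open Literature.AlgebraicGeometry.Milne1999
open NumberField
open Literature.NumberTheory.Automorphic (IsQuaternionAlgebra)
open Literature.AlgebraicGeometry.HodgeTheory.AbelianLowDimension.FivefoldFactHolds
open Literature.AlgebraicGeometry.HodgeTheory.AbelianLowDimension.NonSimpleFourfoldsCodimTwo
open Literature.AlgebraicGeometry.HodgeTheory.AbelianLowDimension.RowFourTypeIVOneOne

variable {X : AbelianVariety ℂ}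

/-! ### §0 The cell: real multiplication of relative dimension two, unconditionally -/

/-- **`B² ⊆ D² (+ Σ W_K)`** for such an `X` (all codimensions are divisorial: `IsDivisorGenerated X`).
[cite: MoonenZarhin1995Duke, Type I(2)] [cite: MoonenZarhin1999LowDim, Thm. 0.1] -/
theorem isCodimTwoDivisorWeilGenerated_of_isTotallyReal_of_two_mul_finrank_eq (hF : IsField X.endAlgebra)
    (hT : IsTotallyReal (EndField X hF)) (he : 2 * Module.finrank ℚ X.endAlgebra = X.dim) :
    IsCodimTwoDivisorWeilGenerated X :=
  haveI := hT
  (AbelianVariety.isDivisorGenerated_of_isTotallyReal_of_two_mul_finrank_eq X hF he).isCodimTwoDivisorWeilGenerated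

/-- **THE RESIDUAL OF THE FOURFOLD FACT, FIFTH REFINEMENT — TYPE I(2) REMOVED.** The named fact
`MoonenZarhin1999_codimTwoHodgeClasses_abelianFourfold` (Thm. 0.1 in codimension two) is EQUIVALENT to its instances at
the simple non-CM fourfolds whose endomorphism algebra is NOT an imaginary quadratic field, which are NOT of minimal
quaternion type, NOT of maximal real-multiplication type, NOT of real-multiplication type of relative dimension two
(`¬ ∃ hF, IsTotallyReal (EndField A hF) ∧ 2 · finrank_ℚ End⁰(A) = dim A`) and NOT of quartic CM type `{(1,1),(2,0)}`: the
type I(2) row is now the Literature lane's UNCONDITIONAL `AbelianVariety.isDivisorGenerated_of_isTotallyReal_of_two_mul_finrank_eq`.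
[cite: MoonenZarhin1995Duke, the type I(2) row] [cite: MoonenZarhin1999LowDim, Thm. 0.1, §2 (2.2)–(2.5)] [cite: Murty1984, §3] -/
theorem moonenZarhin1999_codimTwoHodgeClasses_abelianFourfold_iff_residual_noRelDimTwoRM :
    MoonenZarhin1999_codimTwoHodgeClasses_abelianFourfold ↔
      ∀ A : AbelianVariety ℂ, A.dim = 4 → A.IsSimple → ¬ IsOfCMType A →
        (¬ ∃ (φ : A ⟶ A) (d : ℕ), 0 < d ∧ φ ≫ φ = -(d • 𝟙 A) ∧ Module.finrank ℚ A.endAlgebra = 2) →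
        (¬ ∃ (K : Type) (_ : Field K) (_ : NumberField K) (_ : IsTotallyReal K) (_ : Algebra K A.endAlgebra)
          (_ : IsScalarTower ℚ K A.endAlgebra) (_ : IsQuaternionAlgebra K A.endAlgebra),
            A.dim = 2 * Module.finrank ℚ K) →
        (¬ ∃ hF : IsField A.endAlgebra, NumberField.IsTotallyReal (EndField A hF) ∧
          Module.finrank ℚ A.endAlgebra = A.dim) →
        (¬ ∃ hF : IsField A.endAlgebra, NumberField.IsTotallyReal (EndField A hF) ∧
          2 * Module.finrank ℚ A.endAlgebra = A.dim) →
        (¬ ∃ (φ : A ⟶ A) (μ₁ μ₂ : ℂ), Module.finrank ℚ A.endAlgebra = 4 ∧ starRingEnd ℂ μ₁ ≠ μ₁ ∧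
          starRingEnd ℂ μ₂ ≠ μ₂ ∧ μ₂ ≠ μ₁ ∧ μ₂ ≠ starRingEnd ℂ μ₁ ∧ eigenMultiplicity A φ μ₁ = 1 ∧
          eigenMultiplicity A φ (starRingEnd ℂ μ₁) = 1 ∧ eigenMultiplicity A φ μ₂ = 2) →
        IsCodimTwoDivisorWeilGenerated A := by
  rw [moonenZarhin1999_codimTwoHodgeClasses_abelianFourfold_iff_residual_noImaginaryQuadratic]
  refine ⟨fun h A hA hs hcm hK hQ hT _ hC => h A hA hs hcm hK hQ hT hC, fun h A hA hs hcm hK hQ hT hC => ?_⟩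
  by_cases hR : ∃ hF : IsField A.endAlgebra, NumberField.IsTotallyReal (EndField A hF) ∧
      2 * Module.finrank ℚ A.endAlgebra = A.dim
  · obtain ⟨hF, hTR, he⟩ := hR
    exact isCodimTwoDivisorWeilGenerated_of_isTotallyReal_of_two_mul_finrank_eq hF hTR he
  exact h A hA hs hcm hK hQ hT hR hC

end Literature.AlgebraicGeometry.HodgeTheory.AbelianLowDimension.RowFourTypeITwo

end

/-! ## Part 4: RowFourTypeIIOverQ -/

noncomputable section

open _root_.CategoryTheory _root_.CategoryTheory.Limits

namespace Literature.AlgebraicGeometry.HodgeTheory.AbelianLowDimension.RowFourTypeIIOverQ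

open Literature.AlgebraicGeometry.Motives (AbelianVariety)
open Literature.AlgebraicGeometry.Motives.AbelianVariety
open Literature.AlgebraicGeometry.HodgeTheory
open Literature.AlgebraicGeometry.ComplexMultiplication
open Literature.AlgebraicGeometry.Milne1999
open NumberField
open Literature.NumberTheory.Automorphic (IsQuaternionAlgebra)
open Literature.RingTheory.CentralSimple
open Literature.AlgebraicGeometry.HodgeTheory.AbelianLowDimension.FivefoldFactHolds
open Literature.AlgebraicGeometry.HodgeTheory.AbelianLowDimension.NonSimpleFourfoldsCodimTwo
open Literature.AlgebraicGeometry.HodgeTheory.AbelianLowDimension.RowFourTypeIVOneOne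
open Literature.AlgebraicGeometry.HodgeTheory.AbelianLowDimension.RowFourTypeITwo

variable {X : AbelianVariety ℂ}

/-! ### §0 The cell: type II of quaternion rank two, unconditionally -/

/-- **`B² ⊆ D² (+ Σ W_K)`** for such an `X` (all codimensions are divisorial: `IsDivisorGenerated X`).
[cite: MoonenZarhin1995Duke, Type II] [cite: MoonenZarhin1999LowDim, Thm. 0.1] -/
theorem isCodimTwoDivisorWeilGenerated_of_isSimple_isTotallyIndefinite_rankTwo {K : Type} [Field K] [NumberField K]
    [IsTotallyReal K] [Algebra K X.endAlgebra] [IsScalarTower ℚ K X.endAlgebra] [IsQuaternionAlgebra K X.endAlgebra]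
    (hX : X.IsSimple) (hind : IsTotallyIndefinite K X.endAlgebra) (he : X.dim = 4 * Module.finrank ℚ K) :
    IsCodimTwoDivisorWeilGenerated X :=
  (AbelianVariety.isDivisorGenerated_of_isSimple_isTotallyIndefinite_rankTwo X hX hind he).isCodimTwoDivisorWeilGenerated

/-- **THE RESIDUAL OF THE FOURFOLD FACT, SIXTH REFINEMENT — TYPE II OF QUATERNION RANK TWO REMOVED.** The named fact
`MoonenZarhin1999_codimTwoHodgeClasses_abelianFourfold` (Thm. 0.1 in codimension two) is EQUIVALENT to its instances at
the simple non-CM fourfolds whose endomorphism algebra is NOT an imaginary quadratic field, which are NOT of minimal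
quaternion type, NOT of maximal real-multiplication type, NOT of real-multiplication type of relative dimension two, NOT
OF TYPE II OF QUATERNION RANK TWO (`¬ ∃ K …, IsTotallyIndefinite K End⁰(A) ∧ dim A = 4[K:ℚ]` with `End⁰(A)` a quaternion
algebra over the totally real `K`; for a fourfold, `K = ℚ`) and NOT of quartic CM type `{(1,1),(2,0)}`: the type II row
over `ℚ` is now the Literature lane's UNCONDITIONAL `AbelianVariety.isDivisorGenerated_of_isSimple_isTotallyIndefinite_rankTwo`.
[cite: MoonenZarhin1995Duke, the type II row] [cite: MoonenZarhin1999LowDim, Thm. 0.1, §2 (2.2)–(2.5)] [cite: Gordon1997, §5.9] -/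
theorem moonenZarhin1999_codimTwoHodgeClasses_abelianFourfold_iff_residual_noTypeIIRankTwo :
    MoonenZarhin1999_codimTwoHodgeClasses_abelianFourfold ↔
      ∀ A : AbelianVariety ℂ, A.dim = 4 → A.IsSimple → ¬ IsOfCMType A →
        (¬ ∃ (φ : A ⟶ A) (d : ℕ), 0 < d ∧ φ ≫ φ = -(d • 𝟙 A) ∧ Module.finrank ℚ A.endAlgebra = 2) →
        (¬ ∃ (K : Type) (_ : Field K) (_ : NumberField K) (_ : IsTotallyReal K) (_ : Algebra K A.endAlgebra)
          (_ : IsScalarTower ℚ K A.endAlgebra) (_ : IsQuaternionAlgebra K A.endAlgebra),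
            A.dim = 2 * Module.finrank ℚ K) →
        (¬ ∃ hF : IsField A.endAlgebra, NumberField.IsTotallyReal (EndField A hF) ∧
          Module.finrank ℚ A.endAlgebra = A.dim) →
        (¬ ∃ hF : IsField A.endAlgebra, NumberField.IsTotallyReal (EndField A hF) ∧
          2 * Module.finrank ℚ A.endAlgebra = A.dim) →
        (¬ ∃ (K : Type) (_ : Field K) (_ : NumberField K) (_ : IsTotallyReal K) (_ : Algebra K A.endAlgebra)
          (_ : IsScalarTower ℚ K A.endAlgebra) (_ : IsQuaternionAlgebra K A.endAlgebra),
            IsTotallyIndefinite K A.endAlgebra ∧ A.dim = 4 * Module.finrank ℚ K) →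
        (¬ ∃ (φ : A ⟶ A) (μ₁ μ₂ : ℂ), Module.finrank ℚ A.endAlgebra = 4 ∧ starRingEnd ℂ μ₁ ≠ μ₁ ∧
          starRingEnd ℂ μ₂ ≠ μ₂ ∧ μ₂ ≠ μ₁ ∧ μ₂ ≠ starRingEnd ℂ μ₁ ∧ eigenMultiplicity A φ μ₁ = 1 ∧
          eigenMultiplicity A φ (starRingEnd ℂ μ₁) = 1 ∧ eigenMultiplicity A φ μ₂ = 2) →
        IsCodimTwoDivisorWeilGenerated A := by
  rw [moonenZarhin1999_codimTwoHodgeClasses_abelianFourfold_iff_residual_noRelDimTwoRM]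
  refine ⟨fun h A hA hs hcm hK hQ hT hR _ hC => h A hA hs hcm hK hQ hT hR hC,
    fun h A hA hs hcm hK hQ hT hR hC => ?_⟩
  by_cases hII : ∃ (K : Type) (_ : Field K) (_ : NumberField K) (_ : IsTotallyReal K) (_ : Algebra K A.endAlgebra)
      (_ : IsScalarTower ℚ K A.endAlgebra) (_ : IsQuaternionAlgebra K A.endAlgebra),
        IsTotallyIndefinite K A.endAlgebra ∧ A.dim = 4 * Module.finrank ℚ K
  · obtain ⟨K, _, _, _, _, _, _, hind, he⟩ := hII
    exact isCodimTwoDivisorWeilGenerated_of_isSimple_isTotallyIndefinite_rankTwo hs hind he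
  exact h A hA hs hcm hK hQ hT hR hII hC

end Literature.AlgebraicGeometry.HodgeTheory.AbelianLowDimension.RowFourTypeIIOverQ

end

/-! ## Part 5: RowFourTypeIOneSymplectic -/

noncomputable section

open _root_.CategoryTheory _root_.CategoryTheory.Limits
open scoped TensorProduct

namespace Literature.AlgebraicGeometry.HodgeTheory.AbelianLowDimension.RowFourTypeIOneSymplectic

open Literature.AlgebraicGeometry.Motives (AbelianVariety bettiCohomology HodgeTensorFacts)
open Literature.AlgebraicGeometry.Motives.AbelianVariety
open Literature.AlgebraicGeometry.HodgeTheory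
open Literature.AlgebraicGeometry.ComplexMultiplication
open Literature.AlgebraicGeometry.Milne1999
open NumberField
open Literature.NumberTheory.Automorphic (IsQuaternionAlgebra)
open Literature.RingTheory.CentralSimple
open Literature.AlgebraicGeometry.HodgeTheory.AbelianLowDimension.FivefoldFactHolds
open Literature.AlgebraicGeometry.HodgeTheory.AbelianLowDimension.NonSimpleFourfoldsCodimTwo
open Literature.AlgebraicGeometry.HodgeTheory.AbelianLowDimension.RowFourTypeIVOneOne
open Literature.AlgebraicGeometry.HodgeTheory.AbelianLowDimension.RowFourTypeITwo
open Literature.AlgebraicGeometry.HodgeTheory.AbelianLowDimension.RowFourTypeIIOverQ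

variable [HodgeTensorFacts.{0, 0}] {X : AbelianVariety ℂ}

/-! ### §0 The cell: symplectic Hodge Lie algebra, unconditionally; the fourfold dichotomy -/

/-- **`B•(X) = D•(X) ⊗ ℂ` (`IsDivisorGenerated X`) for every complex abelian variety whose complexified Hodge Lie algebra
contains every `ψ_ℂ`-skew operator (`Hg(X) = Sp(H¹(X;ℚ), ψ)`) — UNCONDITIONAL, every dimension**; the Literature lane's
`AVSlots.isDivisorGenerated_of_hodgeLieC_sp` at the slot `X` itself. MZ99 (1.8) «`Hg(X) = Sp_D(V,φ)` ⟺ … `D(Xⁿ) = B(Xⁿ)`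
for all `n`» (`D = ℚ`, direction ⟹). [cite: MoonenZarhin1999LowDim, §1 (1.8)] [cite: vanGeemen1994HodgeAV, Thm. 4.2] -/
theorem isDivisorGenerated_of_hodgeLieC_sp
    (ψ : (BettiUniverse.hodge exists_isReal_hodgeModel_holds (isSmoothProjective_holds (A := X)) 1).Polarization)
    (hsp : ∀ Y : Module.End ℂ (ℂ ⊗[ℚ] bettiCohomology X.X 1),
      (∀ x y, ψ.form.baseChange ℂ (Y x) y + ψ.form.baseChange ℂ x (Y y) = 0) →
        Y ∈ (BettiUniverse.hodge exists_isReal_hodgeModel_holds (isSmoothProjective_holds (A := X)) 1).hodgeLieC) :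
    IsDivisorGenerated X :=
  (avSlots_self X).isDivisorGenerated_of_hodgeLieC_sp exists_isReal_hodgeModel_holds
    hodgePQ_independent_of_hodgeModel_holds ψ hsp

/-- **`B² ⊆ D² (+ Σ W_K)`** for such an `X` (all codimensions are divisorial). [cite: MoonenZarhin1999LowDim, §1 (1.8) and Thm. 0.1] -/
theorem isCodimTwoDivisorWeilGenerated_of_hodgeLieC_sp
    (ψ : (BettiUniverse.hodge exists_isReal_hodgeModel_holds (isSmoothProjective_holds (A := X)) 1).Polarization)
    (hsp : ∀ Y : Module.End ℂ (ℂ ⊗[ℚ] bettiCohomology X.X 1),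
      (∀ x y, ψ.form.baseChange ℂ (Y x) y + ψ.form.baseChange ℂ x (Y y) = 0) →
        Y ∈ (BettiUniverse.hodge exists_isReal_hodgeModel_holds (isSmoothProjective_holds (A := X)) 1).hodgeLieC) :
    IsCodimTwoDivisorWeilGenerated X :=
  (isDivisorGenerated_of_hodgeLieC_sp ψ hsp).isCodimTwoDivisorWeilGenerated

/-- **THE RESIDUAL OF THE FOURFOLD FACT, SEVENTH REFINEMENT — SYMPLECTIC HODGE LIE ALGEBRA REMOVED.** The named fact
`MoonenZarhin1999_codimTwoHodgeClasses_abelianFourfold` (Thm. 0.1 in codimension two) is EQUIVALENT to its instances at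
the simple non-CM fourfolds whose endomorphism algebra is NOT an imaginary quadratic field, which are NOT of minimal
quaternion type, NOT of maximal real-multiplication type, NOT of real-multiplication type of relative dimension two, NOT
of type II of quaternion rank two, NOT of quartic CM type `{(1,1),(2,0)}`, and whose complexified Hodge Lie algebra is
NOT SYMPLECTIC (`¬ ∃ ψ, ∀ Y, Y ψ_ℂ-skew → Y ∈ Lie Hg(H¹(A)) ⊗ ℂ`): by §0 the symplectic ones are UNCONDITIONALLY
divisorial, and by `hodgeLieC_sp_or_mumford_of_fourfold_endRankOne` the type I(1) fourfolds (`End⁰ = ℚ`) that remain are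
exactly those in the Mumford position. [cite: MoonenZarhin1999LowDim, Thm. (0.1)(3), §1 (1.8), §2 (2.2)–(2.5)]
[cite: MoonenZarhin1995Duke, §2 (type I(1))] [cite: Mumford1969NoteShimura, §4] -/
theorem moonenZarhin1999_codimTwoHodgeClasses_abelianFourfold_iff_residual_noSymplecticTypeIOne :
    MoonenZarhin1999_codimTwoHodgeClasses_abelianFourfold ↔
      ∀ A : AbelianVariety ℂ, A.dim = 4 → A.IsSimple → ¬ IsOfCMType A →
        (¬ ∃ (φ : A ⟶ A) (d : ℕ), 0 < d ∧ φ ≫ φ = -(d • 𝟙 A) ∧ Module.finrank ℚ A.endAlgebra = 2) →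
        (¬ ∃ (K : Type) (_ : Field K) (_ : NumberField K) (_ : IsTotallyReal K) (_ : Algebra K A.endAlgebra)
          (_ : IsScalarTower ℚ K A.endAlgebra) (_ : IsQuaternionAlgebra K A.endAlgebra),
            A.dim = 2 * Module.finrank ℚ K) →
        (¬ ∃ hF : IsField A.endAlgebra, NumberField.IsTotallyReal (EndField A hF) ∧
          Module.finrank ℚ A.endAlgebra = A.dim) →
        (¬ ∃ hF : IsField A.endAlgebra, NumberField.IsTotallyReal (EndField A hF) ∧
          2 * Module.finrank ℚ A.endAlgebra = A.dim) →
        (¬ ∃ (K : Type) (_ : Field K) (_ : NumberField K) (_ : IsTotallyReal K) (_ : Algebra K A.endAlgebra)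
          (_ : IsScalarTower ℚ K A.endAlgebra) (_ : IsQuaternionAlgebra K A.endAlgebra),
            IsTotallyIndefinite K A.endAlgebra ∧ A.dim = 4 * Module.finrank ℚ K) →
        (¬ ∃ (φ : A ⟶ A) (μ₁ μ₂ : ℂ), Module.finrank ℚ A.endAlgebra = 4 ∧ starRingEnd ℂ μ₁ ≠ μ₁ ∧
          starRingEnd ℂ μ₂ ≠ μ₂ ∧ μ₂ ≠ μ₁ ∧ μ₂ ≠ starRingEnd ℂ μ₁ ∧ eigenMultiplicity A φ μ₁ = 1 ∧
          eigenMultiplicity A φ (starRingEnd ℂ μ₁) = 1 ∧ eigenMultiplicity A φ μ₂ = 2) →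
        (¬ ∃ ψ : (BettiUniverse.hodge exists_isReal_hodgeModel_holds (isSmoothProjective_holds (A := A)) 1).Polarization,
          ∀ Y : Module.End ℂ (ℂ ⊗[ℚ] bettiCohomology A.X 1),
            (∀ x y, ψ.form.baseChange ℂ (Y x) y + ψ.form.baseChange ℂ x (Y y) = 0) →
              Y ∈ (BettiUniverse.hodge exists_isReal_hodgeModel_holds (isSmoothProjective_holds (A := A)) 1).hodgeLieC) →
        IsCodimTwoDivisorWeilGenerated A := by
  rw [moonenZarhin1999_codimTwoHodgeClasses_abelianFourfold_iff_residual_noTypeIIRankTwo]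
  refine ⟨fun h A hA hs hcm hK hQ hT hR hII hC _ => h A hA hs hcm hK hQ hT hR hII hC,
    fun h A hA hs hcm hK hQ hT hR hII hC => ?_⟩
  by_cases hSp : ∃ ψ : (BettiUniverse.hodge exists_isReal_hodgeModel_holds (isSmoothProjective_holds (A := A)) 1).Polarization,
      ∀ Y : Module.End ℂ (ℂ ⊗[ℚ] bettiCohomology A.X 1),
        (∀ x y, ψ.form.baseChange ℂ (Y x) y + ψ.form.baseChange ℂ x (Y y) = 0) →
          Y ∈ (BettiUniverse.hodge exists_isReal_hodgeModel_holds (isSmoothProjective_holds (A := A)) 1).hodgeLieC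
  · obtain ⟨ψ, hsp⟩ := hSp
    exact isCodimTwoDivisorWeilGenerated_of_hodgeLieC_sp ψ hsp
  exact h A hA hs hcm hK hQ hT hR hII hC hSp

end Literature.AlgebraicGeometry.HodgeTheory.AbelianLowDimension.RowFourTypeIOneSymplectic

end

/-! ## Part 6: RowFourTypeIOneClosed -/

noncomputable section

open _root_.CategoryTheory _root_.CategoryTheory.Limits
open scoped TensorProduct

namespace Literature.AlgebraicGeometry.HodgeTheory.AbelianLowDimension.RowFourTypeIOneClosed

open Literature.AlgebraicGeometry.Motives (AbelianVariety bettiCohomology HodgeTensorFacts IsSmoothProjective)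
open Literature.AlgebraicGeometry.Motives.AbelianVariety
open Literature.AlgebraicGeometry.HodgeTheory
open Literature.AlgebraicGeometry.ComplexMultiplication
open Literature.AlgebraicGeometry.Milne1999
open Literature.Barriers.HodgeConjecture
open NumberField
open Literature.NumberTheory.Automorphic (IsQuaternionAlgebra)
open Literature.RingTheory.CentralSimple
open Literature.AlgebraicGeometry.HodgeTheory.AbelianLowDimension.FivefoldFactHolds
open Literature.AlgebraicGeometry.HodgeTheory.AbelianLowDimension.NonSimpleFourfoldsCodimTwo
open Literature.AlgebraicGeometry.HodgeTheory.AbelianLowDimension.RowFourTypeIVOneOne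
open Literature.AlgebraicGeometry.HodgeTheory.AbelianLowDimension.RowFourTypeITwo
open Literature.AlgebraicGeometry.HodgeTheory.AbelianLowDimension.RowFourTypeIIOverQ
open Literature.AlgebraicGeometry.HodgeTheory.AbelianLowDimension.RowFourTypeIOneSymplectic

variable [HodgeTensorFacts.{0, 0}] {X : AbelianVariety ℂ}

/-! ### §0 The cell: every complex abelian fourfold with `End⁰ = ℚ`, unconditionally -/

/-- **`B²(X) ⊆ D²(X) ⊗ ℂ` for EVERY complex abelian fourfold with `finrank_ℚ End⁰(X) = 1` — UNCONDITIONAL** (MZ99 Thm. (0.1)(3)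
«Then the Hodge ring `B•(X)` is generated by divisor classes», in codimension two, both branches; a polarization of `H¹` exists
by `smoothProjective_hodgeStructure_isPolarizable_holds`). [cite: MoonenZarhin1999LowDim, Thm. (0.1)(3) and §2 (2.5)(1)]
[cite: MoonenZarhin1995Duke, §2 (type I(1))] [cite: Mumford1969NoteShimura, §4] -/
theorem mem_divisorClassesSpan_two_of_finrank_endAlgebra_eq_one (h1 : Module.finrank ℚ X.endAlgebra = 1) (h4 : X.dim = 4)
    {c : complexBetti X.X (2 * 2)} (hcQ : IsRationalClass c) (hc : IsOfHodgeType X.dim X.X (2 * 2) 2 2 c) :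
    c ∈ divisorClassesSpan X.X X.dim 2 := by
  haveI : Module.Finite ℚ (bettiCohomology X.X 1) := finite_bettiCohomology_one X
  have hX : IsSmoothProjective X.dim X.X := isSmoothProjective_holds
  obtain ⟨ψ⟩ : (BettiUniverse.hodge exists_isReal_hodgeModel_holds (isSmoothProjective_holds (A := X)) 1).IsPolarizable :=
    smoothProjective_hodgeStructure_isPolarizable_holds hX
      (BettiUniverse.realHodgeModel exists_isReal_hodgeModel_holds hX)
      (BettiUniverse.realHodgeModel_isHodgeSymmetric exists_isReal_hodgeModel_holds hX) 1
  exact mem_divisorClassesSpan_two_of_finrank_endAlgebra_eq_one_of_dim_eq_four exists_isReal_hodgeModel_holds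
    hodgePQ_independent_of_hodgeModel_holds h1 h4 ψ hcQ hc

/-- **`IsCodimTwoDivisorWeilGenerated X` (`B²(X) ⊆ D²(X) + Σ W_K`) for EVERY complex abelian fourfold with
`finrank_ℚ End⁰(X) = 1` — UNCONDITIONAL.** [cite: MoonenZarhin1999LowDim, Thm. 0.1 and Thm. (0.1)(3)]
[cite: MoonenZarhin1995Duke, §2 (type I(1))] -/
theorem isCodimTwoDivisorWeilGenerated_of_finrank_endAlgebra_eq_one (h1 : Module.finrank ℚ X.endAlgebra = 1)
    (h4 : X.dim = 4) : IsCodimTwoDivisorWeilGenerated X :=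
  fun _ hcQ hc => Submodule.mem_sup_left (mem_divisorClassesSpan_two_of_finrank_endAlgebra_eq_one h1 h4 hcQ hc)

/-- **THE RESIDUAL OF THE FOURFOLD FACT, EIGHTH REFINEMENT — TYPE I(1) REMOVED.** The named fact
`MoonenZarhin1999_codimTwoHodgeClasses_abelianFourfold` (Thm. 0.1 in codimension two) is EQUIVALENT to its instances at the
simple non-CM fourfolds whose endomorphism algebra is NOT an imaginary quadratic field, which are NOT of minimal quaternion
type, NOT of maximal real-multiplication type, NOT of real-multiplication type of relative dimension two, NOT of type II of
quaternion rank two, NOT of quartic CM type `{(1,1),(2,0)}`, and whose endomorphism algebra has `finrank_ℚ ≠ 1`: by §0 the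
fourfolds with `End⁰ = ℚ` are UNCONDITIONALLY divisorial in codimension two (both branches of the dichotomy). What is left of
Moonen–Zarhin 1995: III over `ℚ`, IV(2,1) `⊇ k` of signature `(2,2)`, IV with `d = 2`.
[cite: MoonenZarhin1999LowDim, Thm. (0.1)(3), §1 (1.8), §2 (2.2)–(2.5)] [cite: MoonenZarhin1995Duke, §2 (type I(1))] -/
theorem moonenZarhin1999_codimTwoHodgeClasses_abelianFourfold_iff_residual_noTypeIOne :
    MoonenZarhin1999_codimTwoHodgeClasses_abelianFourfold ↔
      ∀ A : AbelianVariety ℂ, A.dim = 4 → A.IsSimple → ¬ IsOfCMType A →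
        (¬ ∃ (φ : A ⟶ A) (d : ℕ), 0 < d ∧ φ ≫ φ = -(d • 𝟙 A) ∧ Module.finrank ℚ A.endAlgebra = 2) →
        (¬ ∃ (K : Type) (_ : Field K) (_ : NumberField K) (_ : IsTotallyReal K) (_ : Algebra K A.endAlgebra)
          (_ : IsScalarTower ℚ K A.endAlgebra) (_ : IsQuaternionAlgebra K A.endAlgebra),
            A.dim = 2 * Module.finrank ℚ K) →
        (¬ ∃ hF : IsField A.endAlgebra, NumberField.IsTotallyReal (EndField A hF) ∧
          Module.finrank ℚ A.endAlgebra = A.dim) →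
        (¬ ∃ hF : IsField A.endAlgebra, NumberField.IsTotallyReal (EndField A hF) ∧
          2 * Module.finrank ℚ A.endAlgebra = A.dim) →
        (¬ ∃ (K : Type) (_ : Field K) (_ : NumberField K) (_ : IsTotallyReal K) (_ : Algebra K A.endAlgebra)
          (_ : IsScalarTower ℚ K A.endAlgebra) (_ : IsQuaternionAlgebra K A.endAlgebra),
            IsTotallyIndefinite K A.endAlgebra ∧ A.dim = 4 * Module.finrank ℚ K) →
        (¬ ∃ (φ : A ⟶ A) (μ₁ μ₂ : ℂ), Module.finrank ℚ A.endAlgebra = 4 ∧ starRingEnd ℂ μ₁ ≠ μ₁ ∧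
          starRingEnd ℂ μ₂ ≠ μ₂ ∧ μ₂ ≠ μ₁ ∧ μ₂ ≠ starRingEnd ℂ μ₁ ∧ eigenMultiplicity A φ μ₁ = 1 ∧
          eigenMultiplicity A φ (starRingEnd ℂ μ₁) = 1 ∧ eigenMultiplicity A φ μ₂ = 2) →
        Module.finrank ℚ A.endAlgebra ≠ 1 →
        IsCodimTwoDivisorWeilGenerated A := by
  constructor
  · intro h A hA _ _ _ _ _ _ _ _ _
    exact isCodimTwoDivisorWeilGenerated_of_dim_eq_four_of_fact h hA
  · intro h
    rw [moonenZarhin1999_codimTwoHodgeClasses_abelianFourfold_iff_residual_noSymplecticTypeIOne]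
    intro A hA hs hcm hK hQ hT hR hII hC _
    by_cases h1 : Module.finrank ℚ A.endAlgebra = 1
    · exact isCodimTwoDivisorWeilGenerated_of_finrank_endAlgebra_eq_one h1 hA
    · exact h A hA hs hcm hK hQ hT hR hII hC h1

end Literature.AlgebraicGeometry.HodgeTheory.AbelianLowDimension.RowFourTypeIOneClosed

end

/-! ## Part 7: RowFourTypeIIIOverQ -/

noncomputable section

open _root_.CategoryTheory _root_.CategoryTheory.Limits
open scoped TensorProduct

namespace Literature.AlgebraicGeometry.HodgeTheory.AbelianLowDimension.RowFourTypeIIIOverQ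

open Literature.AlgebraicGeometry.HodgeTheory.NoncommutativeFourfold

open Literature.AlgebraicGeometry.Motives (AbelianVariety HodgeTensorFacts)
open Literature.AlgebraicGeometry.Motives.AbelianVariety
open Literature.AlgebraicGeometry.HodgeTheory
open Literature.AlgebraicGeometry.ComplexMultiplication
open Literature.AlgebraicGeometry.Milne1999
open Literature.Barriers.HodgeConjecture
open NumberField
open Literature.NumberTheory.Automorphic (IsQuaternionAlgebra IsTotallyDefinite)
open Literature.RingTheory.CentralSimple
open Literature.AlgebraicGeometry.HodgeTheory.AbelianLowDimension.FivefoldFactHolds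
open Literature.AlgebraicGeometry.HodgeTheory.AbelianLowDimension.NonSimpleFourfoldsCodimTwo
open Literature.AlgebraicGeometry.HodgeTheory.AbelianLowDimension.RowFourTypeIVOneOne
open Literature.AlgebraicGeometry.HodgeTheory.AbelianLowDimension.RowFourTypeITwo
open Literature.AlgebraicGeometry.HodgeTheory.AbelianLowDimension.RowFourTypeIIOverQ
open Literature.AlgebraicGeometry.HodgeTheory.AbelianLowDimension.RowFourTypeIOneSymplectic
open Literature.AlgebraicGeometry.HodgeTheory.AbelianLowDimension.RowFourTypeIOneClosed

variable {X : AbelianVariety ℂ}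

/-! ### §0 The cell: every complex abelian fourfold with definite quaternion multiplication over `ℚ` -/

/-- **`B²(X) ⊆ D²(X) + Σ_K W_K` (`IsCodimTwoDivisorWeilGenerated X`) for EVERY complex abelian fourfold whose endomorphism algebra is
a totally definite quaternion algebra over `ℚ` — UNCONDITIONAL** (Moonen–Zarhin 1995, type III: «`Hdg²(A) = Div²(A) + V(A)`»; the
Literature lane's `AbelianVariety.isCodimTwoDivisorWeilGenerated_of_isTotallyDefinite_quaternion`).
[cite: MoonenZarhin1995Duke, Type III, Thm. 2.12] [cite: Gordon1997, §5.10 and Thm. 5.2] [cite: MoonenZarhin1999LowDim, Thm. 0.1, (1.4), (1.9)] -/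
theorem isCodimTwoDivisorWeilGenerated_of_isTotallyDefinite_quaternion [IsQuaternionAlgebra ℚ X.endAlgebra]
    (hdef : IsTotallyDefinite ℚ X.endAlgebra) (h4 : X.dim = 4) : IsCodimTwoDivisorWeilGenerated X :=
  AbelianVariety.isCodimTwoDivisorWeilGenerated_of_isTotallyDefinite_quaternion X hdef h4

section Residual

variable [HodgeTensorFacts.{0, 0}]

/-- **THE RESIDUAL OF THE FOURFOLD FACT, NINTH REFINEMENT — TYPE III OVER `ℚ` REMOVED.** The named fact
`MoonenZarhin1999_codimTwoHodgeClasses_abelianFourfold` (Thm. 0.1 in codimension two) is EQUIVALENT to its instances at the simple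
non-CM fourfolds of none of the seven types excluded so far (imaginary quadratic endomorphism algebra, minimal quaternion, maximal real
multiplication, real multiplication of relative dimension two, type II of quaternion rank two, quartic CM `{(1,1),(2,0)}`,
`finrank_ℚ End⁰ = 1`) AND whose endomorphism algebra is NOT a totally definite quaternion algebra over `ℚ`: by §0 those are
UNCONDITIONALLY divisor-plus-Weil generated in codimension two.  What is left of Moonen–Zarhin 1995: IV(2,1) `⊇ k` of signature
`(2,2)`, IV with `d = 2`.  [cite: MoonenZarhin1999LowDim, Thm. 0.1, §1 (1.8), §2 (2.2)–(2.5)] [cite: MoonenZarhin1995Duke, Type III] -/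
theorem moonenZarhin1999_codimTwoHodgeClasses_abelianFourfold_iff_residual_noTypeIII :
    MoonenZarhin1999_codimTwoHodgeClasses_abelianFourfold ↔
      ∀ A : AbelianVariety ℂ, A.dim = 4 → A.IsSimple → ¬ IsOfCMType A →
        (¬ ∃ (φ : A ⟶ A) (d : ℕ), 0 < d ∧ φ ≫ φ = -(d • 𝟙 A) ∧ Module.finrank ℚ A.endAlgebra = 2) →
        (¬ ∃ (K : Type) (_ : Field K) (_ : NumberField K) (_ : IsTotallyReal K) (_ : Algebra K A.endAlgebra)
          (_ : IsScalarTower ℚ K A.endAlgebra) (_ : IsQuaternionAlgebra K A.endAlgebra),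
            A.dim = 2 * Module.finrank ℚ K) →
        (¬ ∃ hF : IsField A.endAlgebra, NumberField.IsTotallyReal (EndField A hF) ∧
          Module.finrank ℚ A.endAlgebra = A.dim) →
        (¬ ∃ hF : IsField A.endAlgebra, NumberField.IsTotallyReal (EndField A hF) ∧
          2 * Module.finrank ℚ A.endAlgebra = A.dim) →
        (¬ ∃ (K : Type) (_ : Field K) (_ : NumberField K) (_ : IsTotallyReal K) (_ : Algebra K A.endAlgebra)
          (_ : IsScalarTower ℚ K A.endAlgebra) (_ : IsQuaternionAlgebra K A.endAlgebra),
            IsTotallyIndefinite K A.endAlgebra ∧ A.dim = 4 * Module.finrank ℚ K) →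
        (¬ ∃ (φ : A ⟶ A) (μ₁ μ₂ : ℂ), Module.finrank ℚ A.endAlgebra = 4 ∧ starRingEnd ℂ μ₁ ≠ μ₁ ∧
          starRingEnd ℂ μ₂ ≠ μ₂ ∧ μ₂ ≠ μ₁ ∧ μ₂ ≠ starRingEnd ℂ μ₁ ∧ eigenMultiplicity A φ μ₁ = 1 ∧
          eigenMultiplicity A φ (starRingEnd ℂ μ₁) = 1 ∧ eigenMultiplicity A φ μ₂ = 2) →
        Module.finrank ℚ A.endAlgebra ≠ 1 →
        (¬ ∃ (_ : IsQuaternionAlgebra ℚ A.endAlgebra), IsTotallyDefinite ℚ A.endAlgebra) →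
        IsCodimTwoDivisorWeilGenerated A := by
  constructor
  · intro h A hA _ _ _ _ _ _ _ _ _ _
    exact isCodimTwoDivisorWeilGenerated_of_dim_eq_four_of_fact h hA
  · intro h
    rw [moonenZarhin1999_codimTwoHodgeClasses_abelianFourfold_iff_residual_noTypeIOne]
    intro A hA hs hcm hK hQ hT hR hII hC h1
    by_cases hIII : ∃ (_ : IsQuaternionAlgebra ℚ A.endAlgebra), IsTotallyDefinite ℚ A.endAlgebra
    · obtain ⟨hq, hdef⟩ := hIII
      haveI := hq
      exact isCodimTwoDivisorWeilGenerated_of_isTotallyDefinite_quaternion hdef hA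
    · exact h A hA hs hcm hK hQ hT hR hII hC h1 hIII

end Residual

end Literature.AlgebraicGeometry.HodgeTheory.AbelianLowDimension.RowFourTypeIIIOverQ

end

/-! ## Part 8: RowFourClosed -/

noncomputable section

open _root_.CategoryTheory _root_.CategoryTheory.Limits
open scoped TensorProduct

namespace Literature.AlgebraicGeometry.HodgeTheory.AbelianLowDimension.RowFourClosed

open Literature.AlgebraicGeometry.HodgeTheory.NoncommutativeFourfold

open Literature.AlgebraicGeometry.Motives (AbelianVariety HodgeTensorFacts)
open Literature.AlgebraicGeometry.Motives.AbelianVariety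
open Literature.AlgebraicGeometry.HodgeTheory
open Literature.AlgebraicGeometry.ComplexMultiplication
open Literature.AlgebraicGeometry.Milne1999
open Literature.Barriers.HodgeConjecture
open NumberField
open Literature.NumberTheory.Automorphic (IsQuaternionAlgebra IsTotallyDefinite)
open Literature.RingTheory.CentralSimple
open Literature.AlgebraicGeometry.HodgeTheory.AbelianLowDimension.FivefoldFactHolds
open Literature.AlgebraicGeometry.HodgeTheory.AbelianLowDimension.RowFourTypeIIIOverQ
open Literature.AlgebraicGeometry.HodgeTheory.EndAlgebraDegreeEightEvenMultiplicity

variable {A : AbelianVariety ℂ}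

/-! ### §1 Albert's arithmetic at `g = 4` and the packaging of the surviving cells -/

/-- **NO complex abelian fourfold lies in the residual class of the census.**  Let `A` be a SIMPLE complex abelian
FOURFOLD NOT of CM type.  Then ONE of the eight excluded hypotheses holds: writing `[End⁰(A):ℚ] = d²e`, `e = [Z:ℚ]`,
`d²e ∣ 8` (Mumford §21; the tree's `exists_sq_mul_finrank_center_dvd_two_mul_dim`): `d = 1` — `End⁰(A)` a field of
degree `1` [`finrank = 1`], `2` [real quadratic: totally real with `2·deg = dim`; imaginary quadratic: `φ ≫ φ = -d`
with `finrank = 2`], `4` [totally real quartic: `deg = dim`; quartic CM: signature `((1,1),(2,0))`, the quartic-CM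
data — the signature `((1,1),(1,1))` being Shimura's empty case (4), the Literature lane's
`exists_eigenMultiplicity_one_one_two_of_isField_of_not_isTotallyReal`], `8` [CM type, excluded]; `d = 2` — `e = 1`:
a quaternion algebra over `ℚ`, definite [type III over `ℚ`] or indefinite [type II of rank two, `dim = 4[ℚ:ℚ]`];
`e = 2`: a quaternion algebra over a real quadratic field with `dim = 2[K:ℚ]` (§1; the imaginary quadratic centre
being Shimura's empty case (5)).  [cite: MoonenZarhin1999LowDim, Thm. 0.1, §1 (1.1), §2 (2.2)–(2.5)]
[cite: Shimura1963AnalyticFamilies, Thm. 5 (cases (4), (5))] [cite: Gordon1997, §1.13.4] [cite: MumfordAV1970, §21 (pp. 201–202)] -/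
theorem rowFour_residual_false (A : AbelianVariety ℂ) (hA4 : A.dim = 4) (hAs : A.IsSimple) (hcm : ¬ IsOfCMType A)
    (h1 : ¬ ∃ (φ : A ⟶ A) (d : ℕ), 0 < d ∧ φ ≫ φ = -(d • 𝟙 A) ∧ Module.finrank ℚ A.endAlgebra = 2)
    (h2 : ¬ ∃ (K : Type) (_ : Field K) (_ : NumberField K) (_ : IsTotallyReal K) (_ : Algebra K A.endAlgebra)
      (_ : IsScalarTower ℚ K A.endAlgebra) (_ : IsQuaternionAlgebra K A.endAlgebra), A.dim = 2 * Module.finrank ℚ K)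
    (h3 : ¬ ∃ hF : IsField A.endAlgebra, NumberField.IsTotallyReal (EndField A hF) ∧
      Module.finrank ℚ A.endAlgebra = A.dim)
    (h4 : ¬ ∃ hF : IsField A.endAlgebra, NumberField.IsTotallyReal (EndField A hF) ∧
      2 * Module.finrank ℚ A.endAlgebra = A.dim)
    (h5 : ¬ ∃ (K : Type) (_ : Field K) (_ : NumberField K) (_ : IsTotallyReal K) (_ : Algebra K A.endAlgebra)
      (_ : IsScalarTower ℚ K A.endAlgebra) (_ : IsQuaternionAlgebra K A.endAlgebra),
        IsTotallyIndefinite K A.endAlgebra ∧ A.dim = 4 * Module.finrank ℚ K)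
    (h6 : ¬ ∃ (φ : A ⟶ A) (μ₁ μ₂ : ℂ), Module.finrank ℚ A.endAlgebra = 4 ∧ starRingEnd ℂ μ₁ ≠ μ₁ ∧
      starRingEnd ℂ μ₂ ≠ μ₂ ∧ μ₂ ≠ μ₁ ∧ μ₂ ≠ starRingEnd ℂ μ₁ ∧ eigenMultiplicity A φ μ₁ = 1 ∧
      eigenMultiplicity A φ (starRingEnd ℂ μ₁) = 1 ∧ eigenMultiplicity A φ μ₂ = 2)
    (h7 : Module.finrank ℚ A.endAlgebra ≠ 1)
    (h8 : ¬ ∃ (_ : IsQuaternionAlgebra ℚ A.endAlgebra), IsTotallyDefinite ℚ A.endAlgebra) : False := by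
  have hA0 : 0 < A.dim := by omega
  haveI : Nontrivial A.endAlgebra := nontrivial_endAlgebra_of_dim_pos hA0
  obtain ⟨d, hd, hde, hdvd⟩ := exists_sq_mul_finrank_center_dvd_two_mul_dim hAs hA0
  rw [hA4] at hdvd
  set e := Module.finrank ℚ ↥(Subalgebra.center ℚ A.endAlgebra) with he
  rcases sq_mul_dvd_eight hd hdvd with ⟨rfl, he'⟩ | ⟨rfl, he'⟩
  · -- `d = 1`: `End⁰(A)` is commutative, a field `F` of degree `e`
    rw [one_pow, one_mul] at hde
    have hF : IsField A.endAlgebra := isField_endAlgebra_of_center_eq_top hAs hA0 (center_eq_top_of_finrank_eq hde)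
    rcases he' with h | h | h | h <;> rw [h] at hde
    · exact h7 hde
    · -- quadratic field
      by_cases hR : IsTotallyReal (EndField A hF)
      · exact h4 ⟨hF, hR, by rw [hde, hA4]⟩
      · obtain ⟨a, q, hq, ha⟩ := AbelianVariety.exists_mul_self_eq_neg_of_finrank_eq_two hA0 hde hF hR
        obtain ⟨φ, n, hn, hφ⟩ := AbelianVariety.exists_hom_comp_self_eq_neg A hq ha
        exact h1 ⟨φ, n, hn, hφ, hde⟩
    · -- quartic field
      by_cases hR : IsTotallyReal (EndField A hF)
      · exact h3 ⟨hF, hR, by rw [hde, hA4]⟩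
      · obtain ⟨β, μ₁, μ₂, hc1, hc2, h21, h21', hm1, hm1', hm2⟩ :=
          AbelianVariety.exists_eigenMultiplicity_one_one_two_of_isField_of_not_isTotallyReal hA4 hF hde hR hcm
        exact h6 ⟨β, μ₁, μ₂, hde, hc1, hc2, h21, h21', hm1, hm1', hm2⟩
    · -- octic field: CM type
      exact hcm (isOfCMType_of_finrank_center_eq_two_mul_dim hAs hA0 (by rw [← he, h, hA4]))
  · rcases he' with h | h <;> rw [h] at hde <;> norm_num at hde
    · -- `d = 2`, `e = 1`: a quaternion algebra over `ℚ`
      have hnc : ∃ x y : A.endAlgebra, x * y ≠ y * x := by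
        by_contra hall
        push Not at hall
        have htop : Subalgebra.center ℚ A.endAlgebra = ⊤ :=
          eq_top_iff.2 fun x _ => Subalgebra.mem_center_iff.2 fun y => hall y x
        have h' := h
        rw [he, htop, (Subalgebra.topEquiv (R := ℚ) (A := A.endAlgebra)).toLinearEquiv.finrank_eq, hde] at h'
        omega
      haveI hQ : IsQuaternionAlgebra ℚ A.endAlgebra := AbelianVariety.isQuaternionAlgebra_endAlgebra_of_isSimple hAs hA0 hde hnc
      rcases isTotallyDefinite_or_isTotallyIndefinite_rat A.endAlgebra with hdef | hind
      · exact h8 ⟨hQ, hdef⟩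
      · exact h5 ⟨ℚ, inferInstance, inferInstance, inferInstance, inferInstance, inferInstance, hQ, hind,
          by rw [Module.finrank_self, hA4]⟩
    · -- `d = 2`, `e = 2`: a quaternion algebra over a quadratic field, necessarily real (§1)
      exact h2 (exists_quaternion_minimal_of_finrank_eq_eight hAs hA4 hde (by rw [← he, h]))

section Holds

variable [HodgeTensorFacts.{0, 0}]

/-- **MOONEN–ZARHIN 1999 Thm. 0.1, CODIMENSION TWO, IS A THEOREM OF THE TREE: the named fact
`MoonenZarhin1999_codimTwoHodgeClasses_abelianFourfold` HOLDS** (under the tree's universal tensor-facts instance,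
discharged by `hodgeTensorFacts_holds`) — for every complex abelian FOURFOLD `X` and every rational `(2,2)`-class
`c ∈ H⁴(X, ℂ)`, `c` lies in the span of the products of divisor classes and of the Weil classes `W_k`, `k = ℚ(φ)`,
`φ ≫ φ = -d`: «`B²(X) = D²(X) + Σ W_k`».  Assembled from the census' localisation
`moonenZarhin1999_codimTwoHodgeClasses_abelianFourfold_iff_residual_noTypeIII` and §2 (the residual is empty).
`HC_CM` does not occur; Markman is not used; no named fact is a hypothesis; nothing is admitted.
[cite: MoonenZarhin1999LowDim, Thm. 0.1 with (1.4), (1.9), §2 (2.2)–(2.5)] [cite: MoonenZarhin1995Duke, Thm. 2.4]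
[cite: Shimura1963AnalyticFamilies, Thm. 5] -/
theorem moonenZarhin1999_codimTwoHodgeClasses_abelianFourfold_holds' :
    MoonenZarhin1999_codimTwoHodgeClasses_abelianFourfold :=
  moonenZarhin1999_codimTwoHodgeClasses_abelianFourfold_iff_residual_noTypeIII.2
    fun A hA4 hAs hcm h1 h2 h3 h4 h5 h6 h7 h8 => (rowFour_residual_false A hA4 hAs hcm h1 h2 h3 h4 h5 h6 h7 h8).elim

end Holds

/-- **THE FOURFOLD FACT HOLDS, instance-free** (`HodgeTensorFacts` discharged by the tree's `hodgeTensorFacts_holds`).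
[cite: MoonenZarhin1999LowDim, Thm. 0.1 with (1.4), (1.9)] [cite: Shimura1963AnalyticFamilies, Thm. 5] -/
theorem _root_.Literature.AlgebraicGeometry.HodgeTheory.MoonenZarhin1999_codimTwoHodgeClasses_abelianFourfold_holds :
    MoonenZarhin1999_codimTwoHodgeClasses_abelianFourfold := by
  haveI : HodgeTensorFacts.{0, 0} := Literature.AlgebraicGeometry.Motives.hodgeTensorFacts_holds.{0, 0}
  exact moonenZarhin1999_codimTwoHodgeClasses_abelianFourfold_holds'

/-- **THE `dim ≤ 5` REDUCTION FACT HOLDS**: the Literature named fact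
`MoonenZarhin1999_hodgeClasses_abelian_dim_le_five_of_weilClassesFourfolds` («Markman's Weil-class theorem for abelian
fourfolds ⟹ every Hodge class on a complex abelian variety of dimension `≤ 5` is algebraic», Moonen–Zarhin Thms.
0.1–0.2 with Markman Cor. 1.3) is a THEOREM of the tree — by the cell's `FivefoldFactHolds` §3 it follows from the
fourfold fact alone. [cite: MoonenZarhin1999LowDim, Thm. 0.1 and Thm. 0.2] [cite: Markman2025SurveySecant, §1.1 and Cor. 1.3] -/
theorem _root_.Literature.AlgebraicGeometry.HodgeTheory.MoonenZarhin1999_hodgeClasses_abelian_dim_le_five_of_weilClassesFourfolds_holds :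
    MoonenZarhin1999_hodgeClasses_abelian_dim_le_five_of_weilClassesFourfolds :=
  moonenZarhin1999_hodgeClasses_abelian_dim_le_five_of_weilClassesFourfolds_of_fourfoldFact
    MoonenZarhin1999_codimTwoHodgeClasses_abelianFourfold_holds

end Literature.AlgebraicGeometry.HodgeTheory.AbelianLowDimension.RowFourClosed

end
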